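import Mathlib
import HarnessLib
import Summits.NavierStokesRegularity.NavierStokesRegularity.Theorems.SubOnsagerCeilingKPLightConeClass

/-!
# Every KP network proper obeys EVERY weighted barrier before one turnover time of the datum shell, ν-uniformly
# (helper file for the crux `SubOnsagerCeiling.ForwardTailCeilingKP`, stmt-NavierStokesRegularity-27057, `--supports`;
# corollary of `Theorems/SubOnsagerCeilingKPLightConeClass.lean` (p839175) and `…KPDarkShell.lean` (low energies never increase))

The registered stubs `stub_primaryGradedLargeRatio` / `stub_primaryGradedSmallRatio` ask, for every KP network proper
`α ∈ E₂(R)` (symmetric, cancelling, comparable, orthant, diagonal feeds), for a ν-uniform weighted shell barrier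
`(1+ε₀)^{2θk}·½X_{i,k}(t)² ≤ D·E₀` (`1/2 < θ ≤ 1`) of the primary modes at ALL times.  This file records, for the WHOLE class and
every `ε₀ > -1`, WHEN such a barrier can first fail: never before the Λ-scaled turnover time of the datum shell.

* `kpClass_superBarrier_before_turnover` — along an honest solution from a one-shell datum on shell `0` (energy `E₀ = Σ_i ½(X₀)_i²`),
  for every `t ∈ [0,s]` with `2 (1+ε₀)^{5/2} √(2E₀) · t ≤ 1` and every shell `j ≥ 0`:
  `(1+ε₀)^{5j} · Σ_i ½X_{i,j}(t)² ≤ E₀` — the SHELL-ENERGY barrier with the super-Kolmogorov exponent `θ = 5/2` and `D = 1`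
  (the datum shell is capped by `2E₀` for all times — `kpProper_lowEnergy_le` with `n = 0` — and the class light cone
  `kpClass_lightCone_sq` from that cap with `k = 0`, `M = √(2E₀)`, `(Kt)^{2^j−1} ≤ 1`).

So for every table of the class the `(θ, D)` barriers of the stubs (`θ ≤ 1 ≤ 5/2`, `D ≥ 1`, per mode `½X_{i,j}² ≤ Σ_i ½X_{i,j}²`) hold
on the initial window `t ≤ 1/(2Λ√(2E₀))`, uniformly in `ν`; a first failure happens only after the datum shell has turned over.
Causality only — not a barrier for all times; no stub is closed.
HONEST FRAMING: statements about Tao-type MODEL lattice ODEs (route SubOnsagerCeiling, rung TL-M2Break); no stub, crux or summit is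
proved here and nothing in this file bears on Navier–Stokes regularity. [cite: Tao2016AveragedNS, §4 (4.2)–(4.3), (4.8), (4.13)]
-/

noncomputable section

-- the sub-problem namespace `NavierStokesRegularity.NavierStokesRegularity` is the tree's layout (D-0017)
set_option linter.dupNamespace false

namespace Summit.NavierStokesRegularity.NavierStokesRegularity.Theorems

open Set Finset MeasureTheory intervalIntegral
open scoped Topology
open Literature.Analysis.FluidPDE.TaoCascade

variable {α : Fin 4 → Fin 4 → Fin 4 → ℤ × ℤ × ℤ → ℝ}

/-- **Super-Kolmogorov shell-energy barrier before one turnover time, for every KP network proper.** Along an honest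
`ν`-viscous solution (`ν ≥ 0`, `1 + ε₀ > 0`) from a one-shell datum `X₀` on shell `0`, continuous, no negative shells, non-negative
on the shells `≥ 1`: for every `t ∈ [0,s]` with `2 (1+ε₀)^{5/2} √(2E₀) t ≤ 1` (`E₀ = Σ_i ½(X₀)_i²`) and every shell `j`,
`(1+ε₀)^{5j} Σ_i ½X_{i,j}(t)² ≤ E₀`, uniformly in `ν`. MODEL lattice statement. [cite: Tao2016AveragedNS, §4 (4.8), (4.13)] -/
theorem kpClass_superBarrier_before_turnover {R : ℝ} (hT : InTableClass R α)
    (hO : ∀ (Y : Fin 4 → ℤ → ℝ → ℝ) (τ : ℝ), (∀ (j : Fin 4) (k : ℤ), 1 ≤ k → 0 ≤ Y j k τ) →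
      ∀ δ : ℝ, 0 < δ → ∀ (i : Fin 4) (n : ℤ), 1 ≤ n → Y i n τ = 0 → 0 ≤ quadTerm δ α Y i n τ)
    (hD : ∀ a b i : Fin 4, a ≠ b → α a b i (0, 0, 1) = 0)
    {ε₀ ν s : ℝ} (hε : -1 < ε₀) (hν : 0 ≤ ν) {X₀ : Fin 4 → ℝ} {X : Fin 4 → ℤ → ℝ → ℝ}
    (hdat : ∀ (i : Fin 4) (k : ℤ), X i k 0 = if k = 0 then X₀ i else 0)
    (hvan : ∀ (i : Fin 4) (k : ℤ), k < 0 → ∀ t : ℝ, X i k t = 0)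
    (hXc : ∀ (i : Fin 4) (k : ℤ), Continuous (X i k))
    (hode : ∀ (i : Fin 4) (k : ℤ), ∀ t ∈ Icc (0 : ℝ) s, HasDerivWithinAt (X i k)
      (quadTerm ε₀ α X i k t - ν * (1 + ε₀) ^ ((2 : ℝ) * k) * X i k t) (Icc (0 : ℝ) s) t)
    (hXpos : ∀ t ∈ Icc (0 : ℝ) s, ∀ (i : Fin 4) (k : ℤ), 1 ≤ k → 0 ≤ X i k t)
    {t : ℝ} (ht : t ∈ Icc (0 : ℝ) s)
    (hturn : 2 * (1 + ε₀) ^ ((5 : ℝ) / 2) * Real.sqrt (2 * ∑ i, (1 / 2 : ℝ) * X₀ i ^ 2) * t ≤ 1) (j : ℕ) :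
    (1 + ε₀) ^ ((5 : ℝ) * (j : ℝ)) * ∑ i, (1 / 2 : ℝ) * X i (j : ℤ) t ^ 2 ≤ ∑ i, (1 / 2 : ℝ) * X₀ i ^ 2 := by
  obtain ⟨hs, hc, _⟩ := hT
  have hb : 0 < 1 + ε₀ := by linarith
  set E₀ : ℝ := ∑ i, (1 / 2 : ℝ) * X₀ i ^ 2 with hE₀
  have hE₀0 : 0 ≤ E₀ := Finset.sum_nonneg fun i _ => by positivity
  set M : ℝ := Real.sqrt (2 * E₀) with hM
  have hM0 : 0 ≤ M := Real.sqrt_nonneg _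
  have hM2 : M ^ 2 = 2 * E₀ := Real.sq_sqrt (by positivity)
  -- the datum shell is capped by `2E₀` at all times (low energies never increase, `n = 0`)
  have hcap : ∀ τ ∈ Icc (0 : ℝ) t, ∑ i, X i ((0 : ℕ) : ℤ) τ ^ 2 ≤ M ^ 2 := by
    intro τ hτ
    have h := kpProper_lowEnergy_le hs hc hO hD hb hν hdat hvan hXc hode hXpos 0 τ ⟨hτ.1, hτ.2.trans ht.2⟩
    simp only [zero_add, Finset.range_one, Finset.sum_singleton] at h
    rw [hM2]
    have h2 : ∑ i, X i ((0 : ℕ) : ℤ) τ ^ 2 = 2 * ∑ i, (1 / 2 : ℝ) * X i ((0 : ℕ) : ℤ) τ ^ 2 := by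
      rw [Finset.mul_sum]
      exact Finset.sum_congr rfl fun i _ => by ring
    rw [h2]
    linarith
  -- the class light cone from that cap with `k = 0`, at the shell `0 + j` and the time `t`
  have hcone := kpClass_lightCone_sq ⟨hs, hc, ‹_›⟩ hO hD hε hν hdat hXc hode hXpos 0 ht hcap j t ⟨ht.1, le_rfl⟩
  have hidx : (((0 + j : ℕ)) : ℤ) = (j : ℤ) := by push_cast; ring
  have hexp1 : (1 + ε₀) ^ ((5 : ℝ) * (((0 : ℕ) : ℝ) + 1) / 2) = (1 + ε₀) ^ ((5 : ℝ) / 2) := by norm_num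
  rw [hidx, hexp1] at hcone
  -- `(K t)^{2^j - 1} ≤ 1`
  set K : ℝ := 2 * (1 + ε₀) ^ ((5 : ℝ) / 2) * M with hK
  have hKt0 : 0 ≤ K * t := mul_nonneg (mul_nonneg (mul_nonneg (by norm_num) (Real.rpow_pos_of_pos hb _).le) hM0) ht.1
  have hKt1 : K * t ≤ 1 := hturn
  have hP0 : 0 ≤ (K * t) ^ (2 ^ j - 1) := pow_nonneg hKt0 _
  have hP : (K * t) ^ (2 ^ j - 1) ≤ 1 := pow_le_one₀ hKt0 hKt1
  set Bj : ℝ := (1 + ε₀) ^ (-((5 : ℝ) * (j : ℝ) / 2)) with hBj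
  have hMB : 0 ≤ (M * Bj) ^ 2 := sq_nonneg _
  have h1 : ∑ i, X i (j : ℤ) t ^ 2 ≤ (M * Bj) ^ 2 := by
    calc ∑ i, X i (j : ℤ) t ^ 2 ≤ (M * Bj * (K * t) ^ (2 ^ j - 1)) ^ 2 := hcone
      _ = (M * Bj) ^ 2 * ((K * t) ^ (2 ^ j - 1)) ^ 2 := by ring
      _ ≤ (M * Bj) ^ 2 * 1 := mul_le_mul_of_nonneg_left (pow_le_one₀ hP0 hP) hMB
      _ = (M * Bj) ^ 2 := mul_one _
  -- the weight `(1+ε₀)^{5j}` cancels `Bj²`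
  have hw : (1 + ε₀) ^ ((5 : ℝ) * (j : ℝ)) * Bj ^ 2 = 1 := by
    rw [hBj, sq, ← Real.rpow_add hb, ← Real.rpow_add hb]
    have : (5 : ℝ) * (j : ℝ) + (-((5 : ℝ) * (j : ℝ) / 2) + -((5 : ℝ) * (j : ℝ) / 2)) = 0 := by ring
    rw [this, Real.rpow_zero]
  have hw0 : 0 ≤ (1 + ε₀) ^ ((5 : ℝ) * (j : ℝ)) := (Real.rpow_pos_of_pos hb _).le
  have hhalf : ∑ i, (1 / 2 : ℝ) * X i (j : ℤ) t ^ 2 = (1 / 2 : ℝ) * ∑ i, X i (j : ℤ) t ^ 2 := by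
    rw [Finset.mul_sum]
  rw [hhalf]
  calc (1 + ε₀) ^ ((5 : ℝ) * (j : ℝ)) * ((1 / 2 : ℝ) * ∑ i, X i (j : ℤ) t ^ 2)
      ≤ (1 + ε₀) ^ ((5 : ℝ) * (j : ℝ)) * ((1 / 2 : ℝ) * (M * Bj) ^ 2) :=
        mul_le_mul_of_nonneg_left (mul_le_mul_of_nonneg_left h1 (by norm_num)) hw0
    _ = (1 / 2 : ℝ) * ((1 + ε₀) ^ ((5 : ℝ) * (j : ℝ)) * Bj ^ 2) * M ^ 2 := by ring
    _ = E₀ := by rw [hw, hM2]; ring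

end Summit.NavierStokesRegularity.NavierStokesRegularity.Theorems

end
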